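import Summits.ResolutionOfSingularities.ResolutionOfSingularities.Theorems.FrobeniusClosingClosingReductionArenaLemmas
import Literature.RingTheory.MvPowerSeries.MaximalIdealPow

/-!
# Stub `stub_arena` of crux `ClosingReduction` (line `chart-factorization`), part 3 of 3:
# ENCODE, DECODE, and `stub_arena : PairDeterminacy → PairIsoKit → Transport → LoewyKit → ArenaE`

Crux `stmt-ResolutionOfSingularities-16347` (`Theses/FrobeniusClosing.lean`, item `ClosingReduction`);
definitions and the statement `ArenaE` in `Theorems/FrobeniusClosingDefs.lean`; parts 1–2 are
`…ArenaDefs.lean`, `…ArenaLemmas.lean`. Helper sub-namespace `ArenaProof`. Proofs only.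

DESIGN. `D = 2β + p + 2`; `e` = an injective enumeration of the non-`p`-th-power monomials of
degree `≤ D`, `e₂` of those of degrees `D+1, …, D+p` (`exists_enum`, from `Set.Finite.fin_param`);
`(M_L, G)` from `LoewyKit` (3) for `e` (coverage since `β + 1 ≤ D`); pieces = charts (`k = n`);
`(P, Q) = (Psys, Qsys)` of part 1; `M = N₂ + n + M_L + M_L`.

* § 10 `clean_stateR_code` — the buffered state built from `code e c` and the cleaned coefficients
  of `c` at `e₂` has the cleaned coefficients of `c` in all degrees `≤ D + p`;
* § 11 `exists_code_ne_zero` — the Loewy bound forces a non-zero recorded coefficient (else every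
  `∂_i (ser c) ∈ 𝔪^D`, so `u_0^β ∈ 𝔪^β ≤ jac c ≤ 𝔪^D` with `β < D`; powers of `𝔪` = jets,
  `Literature/RingTheory/MvPowerSeries/MaximalIdealPow.lean`);
* § 12 `encode` — ENCODE: witness block = (cleaned coefficients of `c` at `e₂`, `τ`, the two Loewy
  witnesses); successor equations by jet locality + universality; `Q` by § 11;
* § 13 `decode_core`, `decode_bddSucc` — DECODE over algebraically closed `K`: `MultP`/`JacPow` of
  the decoded jets and of the buffered state `ĉ` from the shape/Loewy equations,
  `PairIso (decode x) ĉ` and `PairIso (step j τ ĉ) (decode y)` by `PairDeterminacy` (jets agree to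
  degree `D ≥ 2β`), ONE `Transport` (a successor of `decode x` is pair-isomorphic to `step j τ ĉ`;
  its chart change is absorbed by the `∃ i τ` of `BddSucc`) and the kit (symmetry, transitivity,
  invariance of `MultP`/`JacPow`); `CharP K p` from the `ℤ/p`-algebra structure, `PerfectField K`
  from `IsAlgClosed K`;
* `stub_arena` — the registered stub.
-/

noncomputable section

-- single-problem summit: the doubled namespace component `ResolutionOfSingularities` is forced
set_option linter.dupNamespace false

open scoped BigOperators Classical

namespace Summit.ResolutionOfSingularities.ResolutionOfSingularities.Theorems.FrobeniusClosing

namespace ArenaProof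

/-! ## 10. ENCODE's jet agreement -/

section Jets

variable {p n N N₂ : ℕ} {K : Type} [Field K] {e : Fin N → (Fin n → ℕ)} {e₂ : Fin N₂ → (Fin n → ℕ)}

/-- ENCODE's jet agreement: the buffered state built from the jet code of `c` and the cleaned
coefficients of `c` at the buffer monomials has the cleaned coefficients of `c` in all degrees
`≤ D + p`, provided the record `e` is exactly the non-`p`-th-power monomials of degree `≤ D` and the
buffer `e₂` exactly those of degrees `D + 1, …, D + p`. [folklore] -/
theorem clean_stateR_code {D : ℕ}
    (he : ∀ A : Fin n → ℕ, (∃ s, e s = A) ↔ (∑ j, A j ≤ D ∧ ¬ ∀ j, p ∣ A j))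
    (he₂ : ∀ A : Fin n → ℕ, (∃ t, e₂ t = A) ↔ (D < ∑ j, A j ∧ ∑ j, A j ≤ D + p ∧ ¬ ∀ j, p ∣ A j))
    (c : (Fin n → ℕ) → K) (A : Fin n → ℕ) (hA : ∑ j, A j ≤ D + p) :
    clean p n K c A =
      clean p n K (stateR n K e e₂ (code p n K e c) (fun t => clean p n K c (e₂ t))) A := by
  by_cases hdvd : ∀ j, p ∣ A j
  · rw [clean_of_dvd hdvd, clean_of_dvd hdvd]
  · rw [clean_of_not_dvd hdvd, clean_of_not_dvd hdvd]
    unfold stateR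
    split_ifs with h h₂
    · show c A = clean p n K c (e (Classical.choose h))
      rw [Classical.choose_spec h, clean_of_not_dvd hdvd]
    · show c A = clean p n K c (e₂ (Classical.choose h₂))
      rw [Classical.choose_spec h₂, clean_of_not_dvd hdvd]
    · exfalso
      by_cases hle : ∑ j, A j ≤ D
      · exact h ((he A).2 ⟨hle, hdvd⟩)
      · exact h₂ ((he₂ A).2 ⟨by omega, hA, hdvd⟩)

end Jets

/-! ## 11. The Loewy bound forces a non-zero recorded coefficient -/

section Nonzero

open Literature.RingTheory.MvPowerSeries.Jets

variable {p n N : ℕ} {K : Type} [Field K] {e : Fin N → (Fin n → ℕ)}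

/-- If `𝔪^β ≤ jac c` and the record covers the non-`p`-th-power monomials of degree `≤ D` with
`β + 1 ≤ D`, some recorded cleaned coefficient of `c` is non-zero: otherwise every `∂_i (ser c)`
lies in `𝔪^D`, so `u_0^β ∈ 𝔪^β ≤ jac c ≤ 𝔪^D` with `β < D`. [folklore] -/
theorem exists_code_ne_zero {β D : ℕ} (hn : 0 < n) (hβD : β + 1 ≤ D)
    (hrec : ∀ A : Fin n → ℕ, ∑ j, A j ≤ D → (¬ ∀ j, p ∣ A j) → ∃ s, e s = A)
    {c : (Fin n → ℕ) → K} (hJ : JacPow p n K β c) : ∃ s, code p n K e c s ≠ 0 := by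
  by_contra hnone
  push Not at hnone
  have hlow : ∀ A : Fin n → ℕ, ∑ j, A j ≤ D → clean p n K c A = 0 := by
    intro A hA
    by_cases hdvd : ∀ j, p ∣ A j
    · exact clean_of_dvd hdvd
    · obtain ⟨s, rfl⟩ := hrec A hA hdvd
      exact hnone s
  have hjac : jac p n K c ≤ IsLocalRing.maximalIdeal (MvPowerSeries (Fin n) K) ^ D := by
    unfold jac
    rw [Ideal.span_le]
    rintro f ⟨i, rfl⟩
    refine mem_maximalIdeal_pow_of_coeff_eq_zero (fun E hE => ?_)
    show ((E i + 1 : ℕ) : K) * clean p n K c ⇑(E + Finsupp.single i (1 : ℕ)) = 0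
    rw [hlow _ ?_, mul_zero]
    rw [← Finsupp.degree_eq_sum, map_add, Finsupp.degree_single]
    omega
  have hle : IsLocalRing.maximalIdeal (MvPowerSeries (Fin n) K) ^ β ≤ jac p n K c := hJ
  have hmem : MvPowerSeries.monomial (Finsupp.single (⟨0, hn⟩ : Fin n) β) (1 : K) ∈
      IsLocalRing.maximalIdeal (MvPowerSeries (Fin n) K) ^ D :=
    hjac (hle (monomial_mem_maximalIdeal_pow (by rw [Finsupp.degree_single]) 1))
  have h0 := coeff_eq_zero_of_mem_maximalIdeal_pow hmem
    (e := Finsupp.single (⟨0, hn⟩ : Fin n) β) (by rw [Finsupp.degree_single]; omega)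
  rw [MvPowerSeries.coeff_monomial_same] at h0
  exact one_ne_zero h0

end Nonzero

/-! ## 12. ENCODE: an honest step is an edge -/

section Encode

variable {p n N N₂ ML : ℕ} {e : Fin N → (Fin n → ℕ)} {e₂ : Fin N₂ → (Fin n → ℕ)}
  {G : Finset (MvPolynomial (Fin N ⊕ Fin ML) (ZMod p))} {β D : ℕ}

/-- **ENCODE.** For an honest step `c ↦ step i τ c` between multiplicity-`p` states with the Loewy
bound, the witness block `w = (z, τ, wx, wy)` — buffer `z` = cleaned coefficients of `c` in degrees
`D + 1, …, D + p`, the translation `τ`, and the two Loewy witnesses — makes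
`((code c, w), (code (step i τ c), w'))` an edge of `(P, Q)` for every `w'`. [folklore] -/
theorem encode (hn : 0 < n) (hβD : β + 1 ≤ D)
    (he : ∀ A : Fin n → ℕ, (∃ s, e s = A) ↔ (∑ j, A j ≤ D ∧ ¬ ∀ j, p ∣ A j))
    (he₂ : ∀ A : Fin n → ℕ, (∃ t, e₂ t = A) ↔ (D < ∑ j, A j ∧ ∑ j, A j ≤ D + p ∧ ¬ ∀ j, p ∣ A j))
    (hG : ∀ (K : Type) [Field K] [Algebra (ZMod p) K] (c : (Fin n → ℕ) → K),
      JacPow p n K β c ↔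
        ∃ w : Fin ML → K, ∀ g ∈ G, MvPolynomial.aeval (Sum.elim (code p n K e c) w) g = 0)
    (K : Type) [Field K] [Algebra (ZMod p) K] (c : (Fin n → ℕ) → K) (i : Fin n) (τ : Fin n → K)
    (hJ : JacPow p n K β c) (hM : MultP p n K c)
    (hJ' : JacPow p n K β (step p n K i τ c)) (hM' : MultP p n K (step p n K i τ c)) :
    ∃ w : Fin (Msz n N₂ ML) → K, ∀ w' : Fin (Msz n N₂ ML) → K,
      Edge p (Psys p n N N₂ ML e e₂ G) (Qsys p n N N₂ ML) K (Fin.append (code p n K e c) w)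
        (Fin.append (code p n K e (step p n K i τ c)) w') := by
  obtain ⟨wx, hwx⟩ := (hG K c).1 hJ
  obtain ⟨wy, hwy⟩ := (hG K _).1 hJ'
  have hrec : ∀ A : Fin n → ℕ, ∑ j, A j ≤ D → (¬ ∀ j, p ∣ A j) → ∃ s, e s = A :=
    fun A hA hnd => (he A).2 ⟨hA, hnd⟩
  refine ⟨witness (fun t => clean p n K c (e₂ t)) τ wx wy, fun w' => ⟨i, ?_, ?_⟩⟩
  · rw [forall_Psys_iff]
    simp only [Fin.append_left, Fin.append_right, witness_wxIdx, witness_wyIdx, witness_tauIdx,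
      witness_zIdx, aeval_Phi]
    refine ⟨hwx, hwy, fun s hs => ?_, fun s hs => ?_, fun s => ?_⟩
    · by_contra hne
      exact absurd (hM.2 _ hne) (not_le.2 hs)
    · by_contra hne
      exact absurd (hM'.2 _ hne) (not_le.2 hs)
    · show clean p n K (step p n K i τ c) (e s) = _
      rw [clean_step, step_eq_succR_of_multP i τ hM]
      exact succR_congr_of_le i τ (E := D) (fun A hA => clean_stateR_code he he₂ c A hA)
        ((he (e s)).1 ⟨s, rfl⟩).1
  · rw [exists_Qsys_iff]
    simp only [Fin.append_left]
    exact ⟨exists_code_ne_zero hn hβD hrec hJ, exists_code_ne_zero hn hβD hrec hJ'⟩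

end Encode

/-! ## 13. DECODE: an edge over an algebraically closed field is a bounded successor pair -/

section Decode

variable {p n N N₂ ML : ℕ} {e : Fin N → (Fin n → ℕ)} {e₂ : Fin N₂ → (Fin n → ℕ)}
  {G : Finset (MvPolynomial (Fin N ⊕ Fin ML) (ZMod p))} {β D : ℕ}

/-- **DECODE, semantic form.** From the unpacked equations of an edge — Loewy systems for both
jets, shape equations, successor equations against the buffered state, and non-vanishing of both
jets — the decoded jets form a bounded successor pair: determinacy twice (`decode x ~ ĉ`,
`step j τ ĉ ~ decode y`, jets agree to degree `D ≥ 2β`), ONE transport (a successor of `decode x`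
is pair-isomorphic to `step j τ ĉ`), and the kit (symmetry, transitivity, invariance). [folklore] -/
theorem decode_core (hDet : PairDeterminacy) (hKit : PairIsoKit) (hTr : Transport)
    (hp : p.Prime) (hn : 2 ≤ n) (hβD : 2 * β ≤ D) (hpD : p ≤ D + 1)
    (hinj : Function.Injective e)
    (he : ∀ A : Fin n → ℕ, (∃ s, e s = A) ↔ (∑ j, A j ≤ D ∧ ¬ ∀ j, p ∣ A j))
    (he₂ : ∀ A : Fin n → ℕ, (∃ t, e₂ t = A) ↔ (D < ∑ j, A j ∧ ∑ j, A j ≤ D + p ∧ ¬ ∀ j, p ∣ A j))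
    (hG : ∀ (K : Type) [Field K] [Algebra (ZMod p) K] (c : (Fin n → ℕ) → K),
      JacPow p n K β c ↔
        ∃ w : Fin ML → K, ∀ g ∈ G, MvPolynomial.aeval (Sum.elim (code p n K e c) w) g = 0)
    (K : Type) [Field K] [Algebra (ZMod p) K] [IsAlgClosed K]
    (x y : Fin N → K) (z : Fin N₂ → K) (τ : Fin n → K) (wx wy : Fin ML → K) (j : Fin n)
    (hGx : ∀ g ∈ G, MvPolynomial.aeval (Sum.elim x wx) g = 0)
    (hGy : ∀ g ∈ G, MvPolynomial.aeval (Sum.elim y wy) g = 0)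
    (hshx : ∀ s, ∑ j, e s j < p → x s = 0) (hshy : ∀ s, ∑ j, e s j < p → y s = 0)
    (hsucc : ∀ s, y s = succR p n K j τ (stateR n K e e₂ x z) (e s))
    {s₀ s₁ : Fin N} (hs₀ : x s₀ ≠ 0) (hs₁ : y s₁ ≠ 0) :
    BddSucc p n β K (decode n K e x) (decode n K e y) := by
  haveI : Fact p.Prime := ⟨hp⟩
  haveI : CharP K p := charP_of_injective_algebraMap (algebraMap (ZMod p) K).injective p
  haveI : PerfectField K := IsAlgClosed.perfectField K
  have hn0 : 0 < n := by omega
  obtain ⟨hsymm, htrans, hinv⟩ := hKit p hp n hn0 K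
  have he_np : ∀ s, ¬ ∀ j, p ∣ e s j := fun s => ((he (e s)).1 ⟨s, rfl⟩).2
  have he₂_np : ∀ t, ¬ ∀ j, p ∣ e₂ t j := fun t => ((he₂ (e₂ t)).1 ⟨t, rfl⟩).2.2
  have he₂_gt : ∀ t, D < ∑ j, e₂ t j := fun t => ((he₂ (e₂ t)).1 ⟨t, rfl⟩).1
  have hrec : ∀ A : Fin n → ℕ, ∑ j, A j ≤ D → (¬ ∀ j, p ∣ A j) → ∃ s, e s = A :=
    fun A hA hnd => (he A).2 ⟨hA, hnd⟩
  have hnot₂ : ∀ A : Fin n → ℕ, ∑ j, A j ≤ D → ¬ ∃ t, e₂ t = A := by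
    rintro A hA ⟨t, rfl⟩
    exact absurd (he₂_gt t) (not_lt.2 hA)
  -- (a) the two decoded jets
  have hMx : MultP p n K (decode n K e x) := multP_decode hinj he_np hshx hs₀
  have hMy : MultP p n K (decode n K e y) := multP_decode hinj he_np hshy hs₁
  have hJx : JacPow p n K β (decode n K e x) :=
    (hG K _).2 ⟨wx, by rw [code_decode hinj he_np]; exact hGx⟩
  have hJy : JacPow p n K β (decode n K e y) :=
    (hG K _).2 ⟨wy, by rw [code_decode hinj he_np]; exact hGy⟩
  -- (b) the buffered state `ĉ = stateR e e₂ x z`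
  have hMb : MultP p n K (stateR n K e e₂ x z) :=
    multP_stateR hinj he_np he₂_np (fun t => by have := he₂_gt t; omega) z hshx hs₀
  have hjet₁ : ∀ A : Fin n → ℕ, ∑ j, A j ≤ 2 * β →
      clean p n K (decode n K e x) A = clean p n K (stateR n K e e₂ x z) A := by
    intro A hA
    unfold clean
    rw [stateR_eq_decode x z (hnot₂ A (by omega))]
  have hIso₁ : PairIso p n K (decode n K e x) (stateR n K e e₂ x z) :=
    hDet p hp n β K _ _ hn hJx hMx hjet₁
  -- (c) the honest successor `S = step j τ ĉ` has jet code `y`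
  have hSe : ∀ s, step p n K j τ (stateR n K e e₂ x z) (e s) = y s := fun s => by
    rw [step_eq_succR_of_multP j τ hMb]
    exact (hsucc s).symm
  have hcS : clean p n K (step p n K j τ (stateR n K e e₂ x z)) =
      step p n K j τ (stateR n K e e₂ x z) := clean_step j τ _
  have hcodeS : code p n K e (step p n K j τ (stateR n K e e₂ x z)) = y := funext fun s => by
    show clean p n K (step p n K j τ (stateR n K e e₂ x z)) (e s) = y s
    rw [hcS, hSe]
  have hJS : JacPow p n K β (step p n K j τ (stateR n K e e₂ x z)) :=
    (hG K _).2 ⟨wy, by rw [hcodeS]; exact hGy⟩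
  have hMS : MultP p n K (step p n K j τ (stateR n K e e₂ x z)) := by
    refine ⟨⟨e s₁, by rw [hcS, hSe]; exact hs₁⟩, fun A hA => ?_⟩
    by_contra hlt
    push Not at hlt
    obtain ⟨-, hnd⟩ := clean_ne_zero hA
    obtain ⟨s, rfl⟩ := hrec A (by omega) hnd
    rw [hcS, hSe] at hA
    exact hA (hshy s hlt)
  have hjet₂ : ∀ A : Fin n → ℕ, ∑ j, A j ≤ 2 * β →
      clean p n K (step p n K j τ (stateR n K e e₂ x z)) A = clean p n K (decode n K e y) A := by
    intro A hA
    by_cases hdvd : ∀ j, p ∣ A j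
    · rw [clean_of_dvd hdvd, clean_of_dvd hdvd]
    · obtain ⟨s, rfl⟩ := hrec A (by omega) hdvd
      rw [hcS, clean_decode he_np, hSe, decode_apply_e hinj]
  have hIso₂ : PairIso p n K (step p n K j τ (stateR n K e e₂ x z)) (decode n K e y) :=
    hDet p hp n β K _ _ hn hJS hMS hjet₂
  -- (d) transport the successor back to the decoded jet, and assemble
  obtain ⟨j', τ', hST⟩ := hTr p hp n hn0 K (stateR n K e e₂ x z) (decode n K e x)
    (hsymm _ _ hIso₁) hMb j τ
  have hS'S : PairIso p n K (step p n K j' τ' (decode n K e x))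
      (step p n K j τ (stateR n K e e₂ x z)) := hsymm _ _ hST
  obtain ⟨-, hMiff, hJiff⟩ := hinv _ _ hS'S
  exact ⟨j', τ', ⟨hJx, hMx⟩, ⟨(hJiff β).2 hJS, hMiff.2 hMS⟩, ⟨hJy, hMy⟩, htrans _ _ _ hS'S hIso₂⟩

/-- **DECODE.** Over an algebraically closed `K ⊇ ℤ/p`, every edge `(v, v')` of `(P, Q)` yields a
bounded successor pair between the decoded jet blocks. [folklore] -/
theorem decode_bddSucc (hDet : PairDeterminacy) (hKit : PairIsoKit) (hTr : Transport)
    (hp : p.Prime) (hn : 2 ≤ n) (hβD : 2 * β ≤ D) (hpD : p ≤ D + 1)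
    (hinj : Function.Injective e)
    (he : ∀ A : Fin n → ℕ, (∃ s, e s = A) ↔ (∑ j, A j ≤ D ∧ ¬ ∀ j, p ∣ A j))
    (he₂ : ∀ A : Fin n → ℕ, (∃ t, e₂ t = A) ↔ (D < ∑ j, A j ∧ ∑ j, A j ≤ D + p ∧ ¬ ∀ j, p ∣ A j))
    (hG : ∀ (K : Type) [Field K] [Algebra (ZMod p) K] (c : (Fin n → ℕ) → K),
      JacPow p n K β c ↔
        ∃ w : Fin ML → K, ∀ g ∈ G, MvPolynomial.aeval (Sum.elim (code p n K e c) w) g = 0)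
    (K : Type) [Field K] [Algebra (ZMod p) K] [IsAlgClosed K]
    (v v' : Fin (N + Msz n N₂ ML) → K)
    (hE : Edge p (Psys p n N N₂ ML e e₂ G) (Qsys p n N N₂ ML) K v v') :
    BddSucc p n β K (decode n K e (v ∘ Fin.castAdd (Msz n N₂ ML)))
      (decode n K e (v' ∘ Fin.castAdd (Msz n N₂ ML))) := by
  obtain ⟨j, hP, hQ⟩ := hE
  rw [forall_Psys_iff] at hP
  obtain ⟨hGx, hGy, hshx, hshy, hsucc⟩ := hP
  rw [exists_Qsys_iff] at hQ
  obtain ⟨⟨s₀, hs₀⟩, ⟨s₁, hs₁⟩⟩ := hQ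
  refine decode_core hDet hKit hTr hp hn hβD hpD hinj he he₂ hG K _ _
    (fun t => v (Fin.natAdd N (zIdx n N₂ ML t))) (fun l => v (Fin.natAdd N (tauIdx n N₂ ML l)))
    (fun t => v (Fin.natAdd N (wxIdx n N₂ ML t))) (fun t => v (Fin.natAdd N (wyIdx n N₂ ML t))) j
    hGx hGy hshx hshy (fun s => ?_) hs₀ hs₁
  show v' (Fin.castAdd (Msz n N₂ ML) s) = _
  rw [hsucc s, aeval_Phi]
  rfl

end Decode

/-! ## 14. Enumerations of finite sets of exponents -/

/-- Every property of exponent vectors bounding the total degree has an injective enumeration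
`e : Fin N → (Fin n → ℕ)` of exactly its extension. [folklore] -/
theorem exists_enum (n : ℕ) (P : (Fin n → ℕ) → Prop) (D : ℕ) (hP : ∀ A, P A → ∑ j, A j ≤ D) :
    ∃ (N : ℕ) (e : Fin N → (Fin n → ℕ)), Function.Injective e ∧ ∀ A, (∃ s, e s = A) ↔ P A := by
  have hfin : {A : Fin n → ℕ | P A}.Finite := by
    refine Set.Finite.subset
      (Fintype.piFinset (fun _ : Fin n => Finset.range (D + 1))).finite_toSet ?_
    intro A hA
    rw [Finset.mem_coe, Fintype.mem_piFinset]
    intro j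
    rw [Finset.mem_range]
    have h1 := hP A hA
    have h2 : A j ≤ ∑ k, A k :=
      Finset.single_le_sum (fun k _ => Nat.zero_le (A k)) (Finset.mem_univ j)
    omega
  obtain ⟨N, e, hinj, hrange⟩ := hfin.fin_param
  refine ⟨N, e, hinj, fun A => ?_⟩
  rw [← Set.mem_range, hrange]
  rfl

end ArenaProof

/-- **STUB `stub_arena` (size L).** The Diophantine arena `ArenaE` in the support item's native
format, from pair determinacy, the pair-isomorphism kit, transport of successors and the Loewy
kit: record the non-`p`-th-power monomials of degree `≤ D = 2β + p + 2`; a vertex is a jet code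
plus a witness block (buffer of degrees `D+1..D+p`, translation, two Loewy witnesses); the pieces
are the charts; the equations are the Loewy systems, the shape equations, and the UNIVERSAL
successor polynomials (the route's coefficient calculus run once over `(ℤ/p)[v, v']`); the
inequations say both jets are non-zero. ENCODE is jet locality + universality; DECODE is
determinacy twice, one transport, and the kit. [folklore] -/
theorem stub_arena (hD : PairDeterminacy) (hK : PairIsoKit) (hT : Transport) (hL : LoewyKit) :
    ArenaE := by
  intro p hp n hn β
  obtain ⟨N, e, hinj, he⟩ := ArenaProof.exists_enum n
    (fun A => ∑ j, A j ≤ 2 * β + p + 2 ∧ ¬ ∀ j, p ∣ A j) (2 * β + p + 2) (fun A h => h.1)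
  obtain ⟨N₂, e₂, -, he₂⟩ := ArenaProof.exists_enum n
    (fun A => 2 * β + p + 2 < ∑ j, A j ∧ ∑ j, A j ≤ 2 * β + p + 2 + p ∧ ¬ ∀ j, p ∣ A j)
    (2 * β + p + 2 + p) (fun A h => h.2.1)
  obtain ⟨ML, G, hG⟩ := hL.2.2 p hp n (by omega) β N e
    (fun A hA hnd => (he A).2 ⟨by omega, hnd⟩)
  refine ⟨N, ArenaProof.Msz n N₂ ML, n, e, ArenaProof.Psys p n N N₂ ML e e₂ G,
    ArenaProof.Qsys p n N N₂ ML, ?_, ?_⟩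
  · intro K _ _ c i τ hJ hM hJ' hM'
    exact ArenaProof.encode (D := 2 * β + p + 2) (by omega) (by omega) he he₂ hG K c i τ hJ hM
      hJ' hM'
  · intro K _ _ _ v v' hE
    exact ArenaProof.decode_bddSucc hD hK hT hp hn (D := 2 * β + p + 2) (by omega) (by omega)
      hinj he he₂ hG K v v' hE

end Summit.ResolutionOfSingularities.ResolutionOfSingularities.Theorems.FrobeniusClosing
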